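import Mathlib.LinearAlgebra.FiniteDimensional.Lemmas
import Mathlib.LinearAlgebra.Dimension.Constructions
import Mathlib.LinearAlgebra.Matrix.Notation
import Mathlib.Tactic
import HarnessLib

/-!
# The four named top-END directions span — linear algebra of the W1 custody sentence

Kernel index of the arithmetic under `widen/W1/TOPEND-w1cx1.md` (R8)–(R10) and
`W1-NEXT-w1cx1.md` (X19) (computation cell `pub-hsemireg`, W1 sub-lead w1-cx-1, gen 15).
In the gauge of record («gauge B») the value of a closed top-END census word of the design
`t3_080 h+w₁` is a vector of the `(0,1,1)` component `H⁰ ⊗ H¹(𝒪_S) ⊗ H¹(𝒪_S) ≅ K⁴`,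
`K = ℚ(ω)`, written in the coordinates `(v₀₀, v₁₀, v₀₁, v₁₁)` with respect to the frame
`e_{ij} = prᵢ₊₁^*ξ ⊗ prⱼ₊₁^*ξ` (slot 2 ⊗ slot 3).  The census chapter closed on four NAMED
honest `N = 16` words whose exact values lie on the lines spanned by

* WORD A : `(1, 0, 0, 0)`      — `η_p ⊗ pr₁^*ξ`;
* WORD B : `(1, −ω, 0, 0)`     — `η_{c₁} ⊗ pr₁^*ξ` (`v₁₀ = −ω v₀₀`);
* WORD C : `(0, 0, 2, 1 + ω)`  — slot 3 `= pr₂^*ξ`, `v₁₁ = (1+ω)/2 · v₀₁`;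
* word 4580 : `(0, 0, 1, −ω)`  — `η_{c₁} ⊗ pr₂^*ξ` (`v₁₁ = −ω v₀₁`),

and the custody sentence of record reads «(T-ii)-on-T4, (T-iii) and EVERY proper-subspace law
fail together at `N = 16`; rank 4 at 16».  This file is the kernel certificate of the linear
algebra in that sentence and in the two finite-length «laws» it buried:

* `linearIndependent_named`, `span_named_eq_top`, `eq_top_of_named_mem` — the four directions
  are linearly independent, span `K⁴`, and no proper subspace contains them, PROVIDED
  `ω ≠ 0` and `1 + 3ω ≠ 0` (the determinant is `ω (1 + 3ω)`); both provisos hold for a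
  primitive cube root of unity in characteristic `≠ 7` (`omega_ne_zero`,
  `one_add_three_mul_ne_zero`: `ω² + ω + 1 = 0 ∧ 1 + 3ω = 0 ⇒ 7 = 0`), in particular in `ℚ(ω)`
  (`span_named_eq_top_of_cube_root`);
* `hyperplane_named` — A, B, C lie on the hyperplane `(1 + ω) v₀₁ = 2 v₁₁` of (R9) («rank 3 of
  4») and 4580 does not (`(1 + ω) · 1 − 2 · (−ω) = 1 + 3ω ≠ 0`): the hyperplane law was the
  last proper-subspace law to die;
* `dirWitness_mem_Vstar`, `dirA_not_mem_Vstar` — the `N = 14` T4 witness direction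
  `(1, ω, 0, 0) = η_{Γ′₁} ⊗ pr₁^*ξ` lies in `V* = η_{Γ′₁} ⊗ H¹` while the WORD A ∕ T5-carrier
  direction `(1, 0, 0, 0)` does not ((T-ii) «values ⊆ V*» fails on them).

HONEST FRAMING.  Field arithmetic and linear algebra in `K⁴` only: the Lean index of a hand
computation about four explicit vectors.  Which census words carry these directions, and that
their gauge-B values are as recorded, is the cell's machine evidence (codes B ∣ C ∣ D), not a
theorem here.  No abelian variety, sheaf, complex or semiregularity map appears; nothing here
says that HC, HC_CM or HC_AV holds, and nothing here is a new case of anything.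
-/

namespace Summit.Ventures.HSemireg.NamedDirectionsSpan

open Module Submodule

variable {K : Type*} [Field K]

/-! ### The two provisos for a cube root of unity -/

/-- A root of `X² + X + 1` is non-zero. -/
theorem omega_ne_zero {ω : K} (h : ω ^ 2 + ω + 1 = 0) : ω ≠ 0 := by
  rintro rfl
  norm_num at h

/-- A root of `X² + X + 1` has `1 + 3ω ≠ 0` unless `7 = 0` in `K`
(`7 = 9 (ω² + ω + 1) − (3ω + 2)(1 + 3ω)`). -/
theorem one_add_three_mul_ne_zero {ω : K} (h : ω ^ 2 + ω + 1 = 0) (h7 : (7 : K) ≠ 0) :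
    1 + 3 * ω ≠ 0 := by
  intro h'
  apply h7
  have e : (7 : K) = 9 * (ω ^ 2 + ω + 1) - (3 * ω + 2) * (1 + 3 * ω) := by ring
  rw [e, h, h']
  ring

/-! ### The four named directions -/

/-- **Linear independence of the four named directions** `A = (1,0,0,0)`, `B = (1,−ω,0,0)`,
`C = (0,0,2,1+ω)`, `4580 = (0,0,1,−ω)` when `ω ≠ 0` and `1 + 3ω ≠ 0`. -/
theorem linearIndependent_named {ω : K} (hω : ω ≠ 0) (h13 : 1 + 3 * ω ≠ 0) :
    LinearIndependent K
      ![(![1, 0, 0, 0] : Fin 4 → K), ![1, -ω, 0, 0], ![0, 0, 2, 1 + ω], ![0, 0, 1, -ω]] := by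
  rw [Fintype.linearIndependent_iff]
  intro g hg
  have h0 := congr_fun hg 0
  have h1 := congr_fun hg 1
  have h2 := congr_fun hg 2
  have h3 := congr_fun hg 3
  simp [Fin.sum_univ_four] at h0 h1 h2 h3
  -- h0 : g 0 + g 1 = 0 ; h1 : g 1 = 0 ∨ ω = 0 ; h2 : g 2 * 2 + g 3 = 0 ;
  -- h3 : g 2 * (1 + ω) + -(g 3 * ω) = 0
  have g1 : g 1 = 0 := by
    rcases eq_or_ne (g 1) 0 with h | h
    · exact h
    · exfalso; simp_all
  have g0 : g 0 = 0 := by linear_combination h0 - g1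
  have g2 : g 2 = 0 := by
    have : g 2 * (1 + 3 * ω) = 0 := by linear_combination h3 + ω * h2
    rcases mul_eq_zero.mp this with h | h
    · exact h
    · exact absurd h h13
  have g3 : g 3 = 0 := by linear_combination h2 - 2 * g2
  intro i
  fin_cases i <;> assumption

/-- **The four named directions span `K⁴`** («rank 4 at `N = 16`»). -/
theorem span_named_eq_top {ω : K} (hω : ω ≠ 0) (h13 : 1 + 3 * ω ≠ 0) :
    span K (Set.range
      ![(![1, 0, 0, 0] : Fin 4 → K), ![1, -ω, 0, 0], ![0, 0, 2, 1 + ω], ![0, 0, 1, -ω]]) = ⊤ :=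
  (linearIndependent_named hω h13).span_eq_top_of_card_eq_finrank (by simp)

/-- **No proper-subspace law survives the four named words**: a subspace of `K⁴` containing
the four directions is everything. -/
theorem eq_top_of_named_mem {ω : K} (hω : ω ≠ 0) (h13 : 1 + 3 * ω ≠ 0)
    (W : Submodule K (Fin 4 → K)) (hA : (![1, 0, 0, 0] : Fin 4 → K) ∈ W)
    (hB : (![1, -ω, 0, 0] : Fin 4 → K) ∈ W) (hC : (![0, 0, 2, 1 + ω] : Fin 4 → K) ∈ W)
    (hF : (![0, 0, 1, -ω] : Fin 4 → K) ∈ W) : W = ⊤ := by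
  refine eq_top_iff.mpr ?_
  rw [← span_named_eq_top hω h13, span_le]
  rintro _ ⟨i, rfl⟩
  fin_cases i <;> assumption

/-- The `ℚ(ω)` form: for a root of `X² + X + 1` in characteristic `≠ 7` (e.g. characteristic
zero) the four named directions span `K⁴`. -/
theorem span_named_eq_top_of_cube_root {ω : K} (h : ω ^ 2 + ω + 1 = 0) (h7 : (7 : K) ≠ 0) :
    span K (Set.range
      ![(![1, 0, 0, 0] : Fin 4 → K), ![1, -ω, 0, 0], ![0, 0, 2, 1 + ω], ![0, 0, 1, -ω]]) = ⊤ :=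
  span_named_eq_top (omega_ne_zero h) (one_add_three_mul_ne_zero h h7)

/-! ### The hyperplane `(1 + ω) v₀₁ = 2 v₁₁` of (R9) -/

/-- **The hyperplane law and its death.**  The linear form `L v = (1 + ω) v₀₁ − 2 v₁₁`
vanishes on A, B, C and takes the value `1 + 3ω` on 4580. -/
theorem hyperplane_named (ω : K) :
    (1 + ω) * (![1, 0, 0, 0] : Fin 4 → K) 2 - 2 * (![1, 0, 0, 0] : Fin 4 → K) 3 = 0 ∧
    (1 + ω) * (![1, -ω, 0, 0] : Fin 4 → K) 2 - 2 * (![1, -ω, 0, 0] : Fin 4 → K) 3 = 0 ∧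
    (1 + ω) * (![0, 0, 2, 1 + ω] : Fin 4 → K) 2 - 2 * (![0, 0, 2, 1 + ω] : Fin 4 → K) 3 = 0 ∧
    (1 + ω) * (![0, 0, 1, -ω] : Fin 4 → K) 2 - 2 * (![0, 0, 1, -ω] : Fin 4 → K) 3
      = 1 + 3 * ω := by
  refine ⟨by simp, by simp, ?_, ?_⟩ <;> simp <;> ring

/-- Hence 4580's direction is OFF the hyperplane exactly when `1 + 3ω ≠ 0` — in particular for
a cube root of unity in characteristic `≠ 7`. -/
theorem dir4580_off_hyperplane {ω : K} (h13 : 1 + 3 * ω ≠ 0) :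
    (1 + ω) * (![0, 0, 1, -ω] : Fin 4 → K) 2 - 2 * (![0, 0, 1, -ω] : Fin 4 → K) 3 ≠ 0 := by
  rw [(hyperplane_named ω).2.2.2]
  exact h13

/-! ### `V* = η_{Γ′₁} ⊗ H¹` and (T-ii) -/

/-- The `N = 14` T4 witness direction `(1, ω, 0, 0) = η_{Γ′₁} ⊗ pr₁^*ξ` lies in
`V* = span {(1, ω, 0, 0), (0, 0, 1, ω)}`. -/
theorem dirWitness_mem_Vstar (ω : K) :
    (![1, ω, 0, 0] : Fin 4 → K) ∈
      span K (Set.range ![(![1, ω, 0, 0] : Fin 4 → K), ![0, 0, 1, ω]]) :=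
  subset_span ⟨0, rfl⟩

/-- The WORD A ∕ T5-carrier direction `(1, 0, 0, 0)` is NOT in `V*` when `ω ≠ 0`
((T-ii) «values ⊆ V*» fails on those words). -/
theorem dirA_not_mem_Vstar {ω : K} (hω : ω ≠ 0) :
    (![1, 0, 0, 0] : Fin 4 → K) ∉
      span K (Set.range ![(![1, ω, 0, 0] : Fin 4 → K), ![0, 0, 1, ω]]) := by
  intro hmem
  rw [Submodule.mem_span_range_iff_exists_fun] at hmem
  obtain ⟨c, hc⟩ := hmem
  have h0 := congr_fun hc 0
  have h1 := congr_fun hc 1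
  simp [Fin.sum_univ_two] at h0 h1
  -- h0 : c 0 = 1 ; h1 : c 0 = 0 ∨ ω = 0
  rcases h1 with h | h
  · simp_all
  · exact hω h

end Summit.Ventures.HSemireg.NamedDirectionsSpan
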